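import Mathlib

/-!
# Route `FilamentSkeletonRss` · crux `TransverseReduction1AG` (stmt-NavierStokesRegularity-27853; A1L twin stmt-23297) · line
# `defect_column_gate_1AG/1AL` — ASSEMBLY KIT for the two-zone scheme of the azimuthal blocks of S2a-loc `WaistColumnGateLoc1A`:
# the generic bootstrap-closure algebra and the decay of the exterior Biot–Savart source weight

Helper file (`--supports stmt-NavierStokesRegularity-27853 --as helper`; seat ns-filament-s2aloc-p1 g2; note ARCHITECTURE-B2B3-s2aloc-g2.md v3 §7c,
the ASSEMBLY RECIPE).  Pure real analysis, no project imports.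
(1) `bootstrap_closure`: the linear bootstrap that closes the two-zone scheme, stated for bare reals — the exterior lemma's inner datum
`s₀ = s(u₀)` is bounded by the core currencies `IE, D` (short extraction with the full Gaussian discount `e₁ = e^{1/4}/E(u₀)`), the
currencies by the boundary-flux size `Φ` and the exterior remainder `X` (stages 1/1b), and `Φ, X` by the exterior sup hence by `s₀` again
(stage 2 + exterior lemma + feed); if the loop coefficient is `≤ 1/2` the datum `s₀` is bounded by twice the forcing terms.
(2) `sq_mul_exp_neg_antitone`: `(1+u)²e^{−γu/4} ≤ (1+u₀)²e^{−γu₀/4}` for `u ≥ u₀ ≥ 8/γ − 1` — the exterior Biot–Savart source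
`c_B(u)(1+u)²|φ| ≤ (γ²Rc/8πm)(1+u₀)²e^{−γu₀/4}·N` is largest at the inner edge of the exterior zone.
HONEST FRAMING: elementary lemmas serving ONE family of blocks of ONE linear MODEL operator of a hypothetical blow-up route (MODEL rung, negative
side); nothing here bears on NS regularity.
-/

set_option linter.dupNamespace false

noncomputable section

namespace Summit.NavierStokesRegularity.NavierStokesRegularity.Theorems.DefectColumnGate

open scoped Topology
open Set Filter

/-- **Bootstrap closure (generic).**  Nonnegative coefficients (those that multiply inequalities); `s₀ ≤ e₁(α₁·IE + α₂·D)`, `IE ≤ β₀ + β₁Φ + β₂X`, `D ≤ τ₀ + τ₁Φ + τ₂X`,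
`Φ ≤ φ₀ + φ₁s₀`, `X ≤ ξ₀ + ξ₁s₀`, and the loop coefficient `e₁(α₁(β₁φ₁ + β₂ξ₁) + α₂(τ₁φ₁ + τ₂ξ₁)) ≤ 1/2`.  Then
`s₀ ≤ 2e₁(α₁(β₀ + β₁φ₀ + β₂ξ₀) + α₂(τ₀ + τ₁φ₀ + τ₂ξ₀))`. -/
theorem bootstrap_closure {s₀ IE D Φ X e₁ α₁ α₂ β₀ β₁ β₂ τ₀ τ₁ τ₂ φ₀ φ₁ ξ₀ ξ₁ : ℝ}
    (he₁ : 0 ≤ e₁) (hα₁ : 0 ≤ α₁) (hα₂ : 0 ≤ α₂) (hβ₁ : 0 ≤ β₁) (hβ₂ : 0 ≤ β₂) (hτ₁ : 0 ≤ τ₁) (hτ₂ : 0 ≤ τ₂)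
    (hs₀ : 0 ≤ s₀)
    (h1 : s₀ ≤ e₁ * (α₁ * IE + α₂ * D)) (h2 : IE ≤ β₀ + β₁ * Φ + β₂ * X) (h3 : D ≤ τ₀ + τ₁ * Φ + τ₂ * X)
    (h4 : Φ ≤ φ₀ + φ₁ * s₀) (h5 : X ≤ ξ₀ + ξ₁ * s₀)
    (hloop : e₁ * (α₁ * (β₁ * φ₁ + β₂ * ξ₁) + α₂ * (τ₁ * φ₁ + τ₂ * ξ₁)) ≤ 1 / 2) :
    s₀ ≤ 2 * (e₁ * (α₁ * (β₀ + β₁ * φ₀ + β₂ * ξ₀) + α₂ * (τ₀ + τ₁ * φ₀ + τ₂ * ξ₀))) := by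
  -- push `h4`, `h5` into `h2`, `h3`
  have h2' : IE ≤ β₀ + β₁ * φ₀ + β₂ * ξ₀ + (β₁ * φ₁ + β₂ * ξ₁) * s₀ := by
    have a1 := mul_le_mul_of_nonneg_left h4 hβ₁
    have a2 := mul_le_mul_of_nonneg_left h5 hβ₂
    nlinarith
  have h3' : D ≤ τ₀ + τ₁ * φ₀ + τ₂ * ξ₀ + (τ₁ * φ₁ + τ₂ * ξ₁) * s₀ := by
    have a1 := mul_le_mul_of_nonneg_left h4 hτ₁
    have a2 := mul_le_mul_of_nonneg_left h5 hτ₂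
    nlinarith
  -- push into `h1`
  have h1' : s₀ ≤ e₁ * (α₁ * (β₀ + β₁ * φ₀ + β₂ * ξ₀) + α₂ * (τ₀ + τ₁ * φ₀ + τ₂ * ξ₀))
      + e₁ * (α₁ * (β₁ * φ₁ + β₂ * ξ₁) + α₂ * (τ₁ * φ₁ + τ₂ * ξ₁)) * s₀ := by
    have a1 := mul_le_mul_of_nonneg_left h2' hα₁
    have a2 := mul_le_mul_of_nonneg_left h3' hα₂
    have a3 : α₁ * IE + α₂ * D ≤ α₁ * (β₀ + β₁ * φ₀ + β₂ * ξ₀ + (β₁ * φ₁ + β₂ * ξ₁) * s₀)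
        + α₂ * (τ₀ + τ₁ * φ₀ + τ₂ * ξ₀ + (τ₁ * φ₁ + τ₂ * ξ₁) * s₀) := by linarith
    have a4 := mul_le_mul_of_nonneg_left a3 he₁
    linarith [h1]
  have hhalf : e₁ * (α₁ * (β₁ * φ₁ + β₂ * ξ₁) + α₂ * (τ₁ * φ₁ + τ₂ * ξ₁)) * s₀ ≤ 1 / 2 * s₀ :=
    mul_le_mul_of_nonneg_right hloop hs₀
  linarith

/-- **The exterior Biot–Savart source weight decays.**  For `γ > 0`, `8/γ ≤ 1 + u₀`, `u₀ ≤ u`: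
`(1+u)² e^{−γu/4} ≤ (1+u₀)² e^{−γu₀/4}`. -/
theorem sq_mul_exp_neg_antitone {γ u₀ u : ℝ} (hγ : 0 < γ) (hu₀ : 8 / γ ≤ 1 + u₀) (hu : u₀ ≤ u) :
    (1 + u) ^ 2 * Real.exp (-(γ * u / 4)) ≤ (1 + u₀) ^ 2 * Real.exp (-(γ * u₀ / 4)) := by
  have h10 : 0 < 1 + u₀ := lt_of_lt_of_le (by positivity) hu₀
  have h1u : 0 < 1 + u := by linarith
  -- `(1+u)/(1+u₀) ≤ exp((u−u₀)/(1+u₀)) ≤ exp(γ(u−u₀)/8)`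
  have h1 : (1 + u) / (1 + u₀) ≤ Real.exp ((u - u₀) / (1 + u₀)) := by
    have e : (1 + u) / (1 + u₀) = (u - u₀) / (1 + u₀) + 1 := by field_simp; ring
    rw [e]; exact Real.add_one_le_exp _
  have h2 : (u - u₀) / (1 + u₀) ≤ γ * (u - u₀) / 8 := by
    rw [div_le_div_iff₀ h10 (by norm_num)]
    have hd : 0 ≤ u - u₀ := by linarith
    have h8 : 8 ≤ γ * (1 + u₀) := by
      have := mul_le_mul_of_nonneg_left hu₀ hγ.le
      rwa [mul_div_cancel₀ _ hγ.ne'] at this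
    nlinarith [mul_le_mul_of_nonneg_left h8 hd]
  have h3 : (1 + u) / (1 + u₀) ≤ Real.exp (γ * (u - u₀) / 8) := h1.trans (Real.exp_le_exp.mpr h2)
  have h4 : ((1 + u) / (1 + u₀)) ^ 2 ≤ Real.exp (γ * (u - u₀) / 4) := by
    have := pow_le_pow_left₀ (by positivity) h3 2
    rw [← Real.exp_nat_mul] at this
    have e : ((2:ℕ) : ℝ) * (γ * (u - u₀) / 8) = γ * (u - u₀) / 4 := by push_cast; ring
    rwa [e] at this
  -- unfold the exponentials
  have h5 : Real.exp (γ * (u - u₀) / 4) = Real.exp (-(γ * u₀ / 4)) / Real.exp (-(γ * u / 4)) := by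
    rw [← Real.exp_sub]; congr 1; ring
  rw [h5, div_pow, div_le_div_iff₀ (by positivity) (Real.exp_pos _)] at h4
  linarith [h4]

end Summit.NavierStokesRegularity.NavierStokesRegularity.Theorems.DefectColumnGate

end
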